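/-
Copyright (c) 2026 the pub-hodgecm-mathlib formalisation cell (harness21).  Prover seat hodgecm-mathlib-LH4-p01 (g10): road M6 → F3 «TOT-Λ BY OVER-ORDERS» (LEAD F0P3a-plan
T14-66 ∕ T15-32 «GO-LOW»), brick (B2d) «PAIR PACKAGE AT THE INERT PLACE» — the CM WRAPPER (row split inside) — for the F5 pen LH7-p04 (g12) («= WRAPPER YOURS» 02:57:07Z, plumbing (ii)) and
(B2b-II) LH10-p01 (g11); 2026-09-03.
-/
import Literature.NumberTheory.Rogawski1990.TypeTwoPairPackageInertPlaceUniformiser          -- ★-to-be (B2d) U core (this seat): `exists_pairPackage_inertPlace_uniformiserRow`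
import Literature.NumberTheory.Rogawski1990.TypeTwoPairPackageInertPlaceWildUnit             -- ★-to-be (B2d) W core (this seat): `exists_pairPackage_inertPlace_wildUnitRow`
import Literature.NumberTheory.Rogawski1990.DepthZeroKappaTransferTypeTwoRowTwoEisenstein    -- ★ (1) p853295 (LH10-p01 (g11)): the row split's algebra (`mul_eq_neg_one_of_smul_one_sub_eq_of_not_exists_isRoot`, `trace_sq_sub_four_mul_det_smul_one_add_smul`, …); brings ★ α2
import Literature.NumberTheory.LocalFields.InertPlaceSkewDiscriminantRootUniform             -- ★ α1 (LH4-p01 (g9)): `exists_skew_sqrt_discriminant_uniformiser`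
import HarnessLib

/-!
# The type-(2) pair package at an inert CM place — the wrapper over the Eisenstein block (row split inside)

Topic `NumberTheory/Rogawski1990`; namespace `Literature.NumberTheory.Rogawski1990`.  THEOREMS ONLY (no definition, no instance, no notation, no named fact, no `sorry`).
Cell `pub/hodgecm-mathlib` (D-0151), crux H413 = `stmt-HodgeConjecture-24833`; road M6 → F3 «TOT-Λ by over-orders», brick **(B2d) WRAPPER**: for a CM field `L ∕ L⁺` (involution
`c`), an inert UNRAMIFIED place `w ∣ v` of ANY residue characteristic, a hermitian `J ∈ GL₃(𝒪_w)`, a block frame `(cfr, φ_b)`, and an integral pair `(g, u)` over `L_w` with `u·σ_w u = 1`,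
`(σ_w φ_b(g,u))ᵀ·J·φ_b(g,u) = J`, `g ∈ U(antidiag(1,1))` (`(σ_w g)ᵀ·[0 1;1 0]·g = [0 1;1 0]`, the (D1)′ torus currency) carrying the EISENSTEIN BLOCK of ★ F2 (`Θ = α•1 + β•g`,
`|det Θ| = |ϖ|`, `|tr Θ| < 1`, `u•1 − g = a•1 + b•Θ`, `|b| = |ϖ|^{N′}`): the pass-through block X of ★ F5-(0) `ncard_isSelfDualLattice_stable_eq_phiTHn_inertPlace` — an eigen-field model
`M ∕ L` with `w₁ ∣ w`, the θ-package, the endoscopic frame, the root letters, an integral ⋆-polynomial and the gate `hgateV`.  PROOF = the ROW SPLIT of ★ (1)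
`ncard_rankStrata_two_sub_eq_neg_one_pow_mul_of_eisensteinData` (:222–:335, verbatim algebra: `b·β = −1`, `disc g = b²·disc Θ`, `|4 det Θ|` odd vs `|tr Θ|²` even): ODD order of
`tr² − 4det` ⇒ ★ α1 `exists_skew_sqrt_discriminant_uniformiser` ⇒ ★ U core `exists_pairPackage_inertPlace_uniformiserRow`; EVEN order (and non-square) ⇒ ★ α2
`exists_skew_sqrt_discriminant_wildUnit` ⇒ ★ W core `exists_pairPackage_inertPlace_wildUnitRow`; the torus identities `det g·σ_w det g = 1`, `σ_w tr g = tr g·σ_w det g` from ★ (D1)′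
`det_mul_map_det_eq_one_of_unitary_antidiag` ∕ `map_trace_mul_det_eq_trace_of_unitary_antidiag`.  USE ((B2b-II), plumbing (ii)): `obtain ⟨M, _, _, _, w₁, aF, k₀, θ, s', φ, lam, P,
⟨haF, hk₀, hθ, hθv, hcoord, hint, hs'ι, hs'θ, hs's', hs'O, hs'v, hnorm1⟩, ⟨hφ, hstar⟩, ⟨hlam, hφx, hK, hall, hcoordlam⟩, ⟨hP, hPx⟩, hgateV⟩ := exists_pairPackage_inertPlace L w hw hv J hJ hJh cfr
φb hφb hg hu hσu hτJ hgunit hϖ hΘ hΘd hΘt hrel hb` (with `hgunit` = ★ `transpose_map_fst_evalRingHom_mul L v w hw γH` rewritten by ★ `placeForm_antidiagTwo_eq_antidiag`).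
HONEST LABEL: HC_CM is proved only modulo the 2 remaining named inputs (hLiu418 24832, h413 24833) until rung 0 closes; assembly of ★ bricks, asserts nothing printed;
count-neutral (pays no organ; zero label movement until F5 ★ and a desk-priced rider).

* **`exists_pairPackage_inertPlace`**.

## References
* [Rogawski1990] J. D. Rogawski, *Automorphic Representations of Unitary Groups in Three Variables*, Ann. of Math. Stud. 123 (1990): §4.9 Lemma 4.9.3 p. 56, Prop. 4.9.1 (b) p. 55.
* [Flicker1998UnitaryFL] Y. Z. Flicker, *Elementary proof of the fundamental lemma for a unitary group*, Canad. J. Math. 50 (1998): Props. 16–17 pp. 95–97, Theorem 18 p. 97.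
* [Kottwitz1986BaseChangeUnits] R. E. Kottwitz, *Base change for unit elements of Hecke algebras*, Compositio Math. 60 (1986): §1 pp. 240–241, §3.
* [SerreLocalFields1979] J.-P. Serre, *Local Fields*, GTM 67 (1979): Ch. XIV §4, Ch. V §2.
-/

set_option autoImplicit false

noncomputable section

open Matrix Polynomial ValuativeRel NumberField IsDedekindDomain WithZero
open scoped MatrixGroups ValuativeRel Pointwise WithZero
open Literature.NumberTheory.Automorphic Literature.NumberTheory.Automorphic.UnitaryGroup Literature.NumberTheory.NumberFields Literature.NumberTheory.LocalFields
  Literature.NumberTheory.Rogawski1990.Flicker1998 Literature.NumberTheory.Automorphic.UnitaryLatticeTree Literature.NumberTheory.Automorphic.HermitianLattice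

namespace Literature.NumberTheory.Rogawski1990

set_option maxHeartbeats 400000 in
/-- **(B2d) THE PAIR PACKAGE AT AN INERT CM PLACE** (row split inside): from the place, the form, the block frame, the integral pair `(g, u)` — `u·σ_w u = 1`, `φ_b(g,u)` unitary for
`J`, `g` unitary for `antidiag(1,1)` — and its Eisenstein block, the pass-through block X of ★ F5-(0) (eigen-field model `M ∕ L`, `w₁ ∣ w`, θ-package, endoscopic frame, root letters,
⋆-polynomial, gate).  ODD `ord(tr² − 4det)` ⇒ ★ α1 + ★ U core; EVEN ⇒ ★ α2 + ★ W core.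
[cite: Rogawski1990, §4.9 Lemma 4.9.3 p. 56, Prop. 4.9.1 (b) p. 55] [cite: Flicker1998UnitaryFL, Props. 16–17 pp. 95–97] [cite: SerreLocalFields1979, Ch. XIV §4] -/
theorem exists_pairPackage_inertPlace (L : Type) [Field L] [NumberField L] [IsCMField L] {v : HeightOneSpectrum (𝓞 ↥(maximalRealSubfield L))}
    (w : PlacesOver L v) (hw : IsCMField.complexConj L • w.1 = w.1) (hv : Algebra.IsUnramifiedIn (𝓞 L) v.asIdeal)
    -- the form and the block frame
    (J : GL (Fin 3) (w.1.adicCompletion L)) (hJ : J ∈ glInt 3 (w.1.adicCompletion L))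
    (hJh : ((J : Matrix (Fin 3) (Fin 3) (w.1.adicCompletion L)).map (galAdicCompletionMap (L := L) (IsCMField.complexConj L) hw))ᵀ = J)
    (cfr : GL (Fin 3) (w.1.adicCompletion L))
    (φb : (Matrix (Fin 2) (Fin 2) (w.1.adicCompletion L) × w.1.adicCompletion L) →ₐ[w.1.adicCompletion L] Matrix (Fin 3) (Fin 3) (w.1.adicCompletion L))
    (hφb : ∀ (g : Matrix (Fin 2) (Fin 2) (w.1.adicCompletion L)) (u : w.1.adicCompletion L),
      φb (g, u) = (cfr : Matrix (Fin 3) (Fin 3) (w.1.adicCompletion L)) *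
        Matrix.reindex endoPerm endoPerm (Matrix.fromBlocks g 0 0 (u • (1 : Matrix (Fin 1) (Fin 1) (w.1.adicCompletion L)))) *
        ((cfr⁻¹ : GL (Fin 3) (w.1.adicCompletion L)) : Matrix (Fin 3) (Fin 3) (w.1.adicCompletion L)))
    -- the integral unitary pair, its torus identities, its Eisenstein letters
    {g : Matrix (Fin 2) (Fin 2) (w.1.adicCompletion L)} {u : w.1.adicCompletion L}
    (hg : ∀ i j, g i j ∈ 𝒪[w.1.adicCompletion L]) (hu : u ∈ 𝒪[w.1.adicCompletion L]) (hσu : u * galAdicCompletionMap (L := L) (IsCMField.complexConj L) hw u = 1)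
    (hτJ : ((φb (g, u)).map (galAdicCompletionMap (L := L) (IsCMField.complexConj L) hw))ᵀ * (J : Matrix (Fin 3) (Fin 3) (w.1.adicCompletion L)) * φb (g, u) = J)
    (hgunit : (g.map (galAdicCompletionMap (L := L) (IsCMField.complexConj L) hw))ᵀ * (!![0, 1; 1, 0] : Matrix (Fin 2) (Fin 2) (w.1.adicCompletion L)) * g = !![0, 1; 1, 0])
    {ϖ : w.1.adicCompletion L} (hϖ : Valued.v ϖ = WithZero.exp (-1 : ℤ))
    {Θ : Matrix (Fin 2) (Fin 2) (w.1.adicCompletion L)} {α β a b : w.1.adicCompletion L} {N' : ℕ}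
    (hΘ : Θ = α • 1 + β • g) (hΘd : Valued.v Θ.det = Valued.v ϖ) (hΘt : Valued.v Θ.trace < 1)
    (hrel : u • (1 : Matrix (Fin 2) (Fin 2) (w.1.adicCompletion L)) - g = a • 1 + b • Θ) (hb : Valued.v b = Valued.v ϖ ^ N') :
    ∃ (M : Type) (_ : Field M) (_ : NumberField M) (_ : Algebra L M) (w₁ : PlacesOver M w.1)
      (aF k₀ : v.adicCompletion ↥(maximalRealSubfield L)) (θ : w₁.1.adicCompletion M) (s' : w₁.1.adicCompletion M →+* w₁.1.adicCompletion M)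
      (φ : (w.1.adicCompletion L × w₁.1.adicCompletion M) →ₐ[w.1.adicCompletion L] Matrix (Fin 3) (Fin 3) (w.1.adicCompletion L))
      (lam : w₁.1.adicCompletion M) (P : (w.1.adicCompletion L)[X]),
      -- the θ-package (★ F5-(0)'s letters `haF hk₀ hθ hθv hcoord hint hs'ι hs'θ hs's' hs'O hs'v hnorm1`)
      (Valued.v aF < 1 ∧ Valued.v k₀ = WithZero.exp (-1 : ℤ) ∧
        θ ^ 2 = toPlace w.1 w₁ (toPlace v w aF) * θ + toPlace w.1 w₁ (toPlace v w k₀) ∧ Valued.v θ = WithZero.exp (-1 : ℤ) ∧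
        (∀ z : w₁.1.adicCompletion M, ∃! pq : w.1.adicCompletion L × w.1.adicCompletion L, z = toPlace w.1 w₁ pq.1 + toPlace w.1 w₁ pq.2 * θ) ∧
        (∀ p q : w.1.adicCompletion L, toPlace w.1 w₁ p + toPlace w.1 w₁ q * θ ∈ 𝒪[w₁.1.adicCompletion M] ↔
          p ∈ 𝒪[w.1.adicCompletion L] ∧ q ∈ 𝒪[w.1.adicCompletion L]) ∧
        (∀ x, s' (toPlace w.1 w₁ x) = toPlace w.1 w₁ (galAdicCompletionMap (L := L) (IsCMField.complexConj L) hw x)) ∧ s' θ = θ ∧ (∀ z, s' (s' z) = z) ∧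
        (∀ z : 𝒪[w₁.1.adicCompletion M], s' z ∈ 𝒪[w₁.1.adicCompletion M]) ∧ (∀ z, Valued.v (s' z) = Valued.v z) ∧
        (∀ c₁ : w₁.1.adicCompletion M, c₁ ≠ 0 → s' c₁ = c₁ → Even (WithZero.log (Valued.v c₁)) → ∃ a : w₁.1.adicCompletion M, a * s' a * c₁ = 1)) ∧
      -- the endoscopic frame (`hφ hstar`)
      (Function.Injective φ ∧
        (∀ b : w.1.adicCompletion L × w₁.1.adicCompletion M, (J : Matrix (Fin 3) (Fin 3) (w.1.adicCompletion L)) *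
          φ (RingHom.prodMap (galAdicCompletionMap (L := L) (IsCMField.complexConj L) hw) s' b) = ((φ b).map (galAdicCompletionMap (L := L) (IsCMField.complexConj L) hw))ᵀ * J)) ∧
      -- the root (`hlam hφx hK hall hcoordlam`)
      (lam ^ 2 - toPlace w.1 w₁ g.trace * lam + toPlace w.1 w₁ g.det = 0 ∧
        φ ((u, lam) : w.1.adicCompletion L × w₁.1.adicCompletion M) = φb (g, u) ∧
        IsUnit (Matrix.of fun i j : Fin 3 => (((φb (g, u)) ^ (j : ℕ)) *ᵥ ((cfr : Matrix (Fin 3) (Fin 3) (w.1.adicCompletion L)) *ᵥ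
          (Pi.single (endoPerm (Sum.inl 0)) (1 : w.1.adicCompletion L) + Pi.single (endoPerm (Sum.inr 0)) (1 : w.1.adicCompletion L)))) i).det ∧
        (∀ x : w.1.adicCompletion L × w₁.1.adicCompletion M, ∃ Q : (w.1.adicCompletion L)[X],
          aeval ((u, lam) : w.1.adicCompletion L × w₁.1.adicCompletion M) Q = x) ∧
        (∀ z : w₁.1.adicCompletion M, ∃ p q : w.1.adicCompletion L, z = toPlace w.1 w₁ p + toPlace w.1 w₁ q * lam)) ∧
      -- the ⋆-polynomial (`hP hPx`)
      ((∀ i, P.coeff i ∈ 𝒪[w.1.adicCompletion L]) ∧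
        aeval ((u, lam) : w.1.adicCompletion L × w₁.1.adicCompletion M) P = (galAdicCompletionMap (L := L) (IsCMField.complexConj L) hw u, s' lam)) ∧
      -- the gate (`hgateV`)
      (∀ (u' p' q' t' D' : w.1.adicCompletion L) (N'' b' : ℕ),
        ((u', toPlace w.1 w₁ p' + toPlace w.1 w₁ q' * θ) : w.1.adicCompletion L × w₁.1.adicCompletion M) *
          RingHom.prodMap (galAdicCompletionMap (L := L) (IsCMField.complexConj L) hw) s'
            ((u', toPlace w.1 w₁ p' + toPlace w.1 w₁ q' * θ) : w.1.adicCompletion L × w₁.1.adicCompletion M) = 1 →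
        Valued.v (u' - 1) < 1 → Valued.v (p' - 1) < 1 → Valued.v q' = WithZero.exp (-(N'' : ℤ)) →
        (toPlace w.1 w₁ p' + toPlace w.1 w₁ q' * θ) ^ 2 - toPlace w.1 w₁ t' * (toPlace w.1 w₁ p' + toPlace w.1 w₁ q' * θ) + toPlace w.1 w₁ D' = 0 →
        Valued.v (u' * u' - t' * u' + D') = WithZero.exp (-(b' : ℤ)) →
        ((∃ x : Fin 3 → w.1.adicCompletion L, ∃ g₁ ∈ unitaryGroupOfForm (galAdicCompletionMap (L := L) (IsCMField.complexConj L) hw) (J : Matrix (Fin 3) (Fin 3) (w.1.adicCompletion L)),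
          Submodule.span 𝒪[w.1.adicCompletion L] (Set.range fun k : Fin 3 =>
            ((φ ((u', toPlace w.1 w₁ p' + toPlace w.1 w₁ q' * θ) : w.1.adicCompletion L × w₁.1.adicCompletion M)) ^ (k : ℕ)) *ᵥ x) =
            Submodule.span 𝒪[w.1.adicCompletion L] (Set.range ((g₁ : Matrix (Fin 3) (Fin 3) (w.1.adicCompletion L)))ᵀ)) ↔
        Even (WithZero.log (Valued.v (∑ k, ∑ i,
          galAdicCompletionMap (L := L) (IsCMField.complexConj L) hw (((cfr : Matrix (Fin 3) (Fin 3) (w.1.adicCompletion L)) *ᵥ Pi.single (endoPerm (Sum.inr 0)) (1 : w.1.adicCompletion L)) i) *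
          (J : Matrix (Fin 3) (Fin 3) (w.1.adicCompletion L)) i k *
          ((cfr : Matrix (Fin 3) (Fin 3) (w.1.adicCompletion L)) *ᵥ Pi.single (endoPerm (Sum.inr 0)) (1 : w.1.adicCompletion L)) k)) + b'))) := by
  classical
  haveI : Algebra.IsQuadraticExtension ↥(maximalRealSubfield L) L := IsCMField.isQuadraticExtension L
  have hc1 : IsCMField.complexConj L ≠ 1 := IsCMField.complexConj_ne_one L
  -- ABBREVIATIONS: `σ = σ_w`, `t = tr g`, `D = det g`
  set σ : w.1.adicCompletion L →+* w.1.adicCompletion L := galAdicCompletionMap (L := L) (IsCMField.complexConj L) hw with hσdef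
  set t : w.1.adicCompletion L := g.trace with htdef
  set D : w.1.adicCompletion L := g.det with hDdef
  -- (0) valuations at `w`: `|ι a|_w = |a|_v`, `|2|_w = exp(−e)`
  have hιv : ∀ x : v.adicCompletion ↥(maximalRealSubfield L), Valued.v (toPlace v w x) = Valued.v x :=
    fun x => Literature.NumberTheory.Automorphic.Liu2021.LemD1IndexedNonVacuityInertCofinite.valued_toPlace_of_isUnramifiedIn L v hv w x
  haveI : CharZero (v.adicCompletion ↥(maximalRealSubfield L)) :=
    charZero_of_injective_algebraMap (algebraMap ↥(maximalRealSubfield L) (v.adicCompletion ↥(maximalRealSubfield L))).injective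
  have h2le : Valued.v (2 : v.adicCompletion ↥(maximalRealSubfield L)) ≤ 1 := by
    rw [← one_add_one_eq_two]; exact Valuation.map_add_le _ (by rw [map_one]) (by rw [map_one])
  obtain ⟨e, he⟩ := exists_v_eq_exp_neg_nat (two_ne_zero : (2 : v.adicCompletion ↥(maximalRealSubfield L)) ≠ 0) h2le
  have he' : Valued.v (2 : w.1.adicCompletion L) = exp (-(e : ℤ)) := by rw [← map_ofNat (toPlace v w) 2, hιv, he]
  have h4' : Valued.v (4 : w.1.adicCompletion L) = exp (-(2 * (e : ℤ))) := by
    rw [show (4 : w.1.adicCompletion L) = 2 * 2 by norm_num, Valuation.map_mul, he', ← exp_add]; congr 1; ring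
  have hvϖ0 : Valued.v ϖ ≠ 0 := by rw [hϖ]; exact exp_ne_zero
  -- `χ_g` rootless (★ (c5-i), from the Eisenstein letters), in the `IsRoot` spelling of ★ (1)
  obtain ⟨-, -, hirr0, -⟩ := charpoly_ne_zero_of_eisensteinData hϖ hΘ hΘd hΘt
  have hirr : ¬ ∃ x : w.1.adicCompletion L, (g.charpoly).IsRoot x := by
    rintro ⟨x, hx⟩
    refine hirr0 x ?_
    rw [Matrix.charpoly_fin_two, Polynomial.IsRoot.def] at hx
    simp only [eval_add, eval_sub, eval_mul, eval_pow, eval_C, eval_X] at hx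
    linear_combination hx
  -- (1) `bβ = −1`, `disc g = b²·disc Θ`
  have hbβ : b * β = -1 := mul_eq_neg_one_of_smul_one_sub_eq_of_not_exists_isRoot g hirr hΘ hrel
  have hdiscΘ : Θ.trace ^ 2 - 4 * Θ.det = β ^ 2 * (t ^ 2 - 4 * D) := by
    rw [hΘ]; exact trace_sq_sub_four_mul_det_smul_one_add_smul g α β
  have hdisc : t ^ 2 - 4 * D = b ^ 2 * (Θ.trace ^ 2 - 4 * Θ.det) := by
    rw [hdiscΘ]
    have hb2 : b ^ 2 * β ^ 2 = 1 := by rw [← mul_pow, hbβ]; norm_num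
    linear_combination (-(t ^ 2 - 4 * D)) * hb2
  have hvb : Valued.v b = exp (-(N' : ℤ)) := by rw [hb, hϖ, exp_neg_one_pow]
  -- the torus identities (★ (D1)′)
  have hσD : D * σ D = 1 := det_mul_map_det_eq_one_of_unitary_antidiag σ g hgunit
  have hσt : σ t = t * σ D := by
    have h := map_trace_mul_det_eq_trace_of_unitary_antidiag σ g hgunit
    calc σ t = σ t * (D * σ D) := by rw [hσD, mul_one]
      _ = σ t * D * σ D := by ring
      _ = t * σ D := by rw [h]
  -- (2) `|4 det Θ| = exp(−(2e+1))` (odd) vs. `|tr Θ²| = |tr Θ|²` (a square value)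
  have h4det : Valued.v (4 * Θ.det) = exp (-(2 * (e : ℤ) + 1)) := by
    rw [Valuation.map_mul, h4', hΘd, hϖ, ← exp_add]; congr 1; ring
  have htr2 : Valued.v (Θ.trace ^ 2) = Valued.v Θ.trace * Valued.v Θ.trace := by rw [Valuation.map_pow, pow_two]
  have hne : Valued.v (Θ.trace ^ 2) ≠ Valued.v (4 * Θ.det) := by
    rw [htr2, h4det]; exact mul_self_ne_exp_neg_two_mul_add_one _ _
  rcases hne.lt_or_gt with hlt | hgt
  · -- ===== ODD ROW (uniformiser row): `ord disc g = 2(N′+e)+1`, ★ α1, ★ U core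
    have hdΘ : Valued.v (Θ.trace ^ 2 - 4 * Θ.det) = exp (-(2 * (e : ℤ) + 1)) := by rw [valued_sub_eq_of_lt_right hlt, h4det]
    have hN : Valued.v (t ^ 2 - 4 * D) = WithZero.exp (-((2 * (N' + e) + 1 : ℕ) : ℤ)) := by
      rw [hdisc, Valuation.map_mul, Valuation.map_pow, hvb, hdΘ, ← WithZero.exp_nsmul, ← exp_add]
      congr 1; push_cast; ring
    obtain ⟨y, k₀, hy0, hk₀, hD, hσy, -⟩ := LocalFields.exists_skew_sqrt_discriminant_uniformiser L v w hw hv hσD hσt hN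
    exact exists_pairPackage_inertPlace_uniformiserRow (IsCMField.complexConj L) v hc1 hv w hw J hJ hJh cfr φb hφb hg hu hσu hτJ hσD hσt hϖ hΘ hΘd hΘt hy0 hk₀ hD hσy
  · -- ===== EVEN ROW (wild unit row): `disc g` a non-square of even order, ★ α2, ★ W core
    have htr0 : Θ.trace ≠ 0 := by
      intro h0
      rw [h0, zero_pow two_ne_zero, Valuation.map_zero] at hgt
      exact (not_lt.2 zero_le) hgt
    obtain ⟨m, hmv⟩ := exists_v_eq_exp_neg_nat htr0 hΘt.le
    have hdΘ : Valued.v (Θ.trace ^ 2 - 4 * Θ.det) = exp (-(2 * (m : ℤ))) := by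
      rw [valued_sub_eq_of_lt_left hgt, htr2, hmv, ← exp_add]; congr 1; ring
    have hM : Valued.v (t ^ 2 - 4 * D) = WithZero.exp (-(2 * ((N' + m : ℕ) : ℤ))) := by
      rw [hdisc, Valuation.map_mul, Valuation.map_pow, hvb, hdΘ, ← WithZero.exp_nsmul, ← exp_add]
      congr 1; push_cast; ring
    haveI : CharZero (w.1.adicCompletion L) := charZero_of_injective_algebraMap (algebraMap L (w.1.adicCompletion L)).injective
    have hns : ¬ IsSquare (t ^ 2 - 4 * D) := by
      rintro ⟨s, hs⟩
      refine hirr ⟨(t + s) / 2, ?_⟩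
      rw [Matrix.charpoly_fin_two, Polynomial.IsRoot.def]
      simp only [eval_add, eval_sub, eval_mul, eval_pow, eval_C, eval_X]
      rw [← htdef, ← hDdef]
      have hx : ((t + s) / 2) ^ 2 - t * ((t + s) / 2) + D = (s * s - (t ^ 2 - 4 * D)) / 4 := by
        field_simp
        ring
      rw [hx, ← hs, sub_self, zero_div]
    obtain ⟨y, d₀, wd, k, hy0, hD, hσy, hdw, hwd, h4w, -⟩ := LocalFields.exists_skew_sqrt_discriminant_wildUnit L v w hw hv hσD hσt hM hns
    have hvϖF : Valued.v (Literature.NumberTheory.GaloisRepresentations.HeckeCharacter.uniformizer ↥(maximalRealSubfield L) v : v.adicCompletion ↥(maximalRealSubfield L)) = WithZero.exp (-1 : ℤ) := by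
      rw [← hιv]; exact valued_toPlace_uniformizer L v w hv
    exact exists_pairPackage_inertPlace_wildUnitRow (IsCMField.complexConj L) v hc1 hv w hw J hJ hJh cfr φb hφb hg hu hσu hτJ hσD hσt hϖ hΘ hΘd hΘt hy0 hdw hwd h4w hD hσy hvϖF

end Literature.NumberTheory.Rogawski1990
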